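import Mathlib
import Summits.RiemannHypothesis.Statement
import Summits.RiemannHypothesis.RiemannHypothesis.Theorems.LiAsymptoticDefs
import Summits.RiemannHypothesis.RiemannHypothesis.Theorems.LiAsymptoticLawProof
import Literature.NumberTheory.LFunctions.KeiperLiAsymptoticCriteria
import Literature.NumberTheory.LFunctions.KeiperLiAsymptoticCriteriaProofs
import Literature.NumberTheory.DiophantineGeometry.NamedHypotheses
import HarnessLib
import HarnessLib.Audit

/-!
# RiemannHypothesis / COLUMN 4 (LI) — Lagarias' law (1.18) under RH for all `n`, and the `O(√n log n)` FENCE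

LINE 1 — LABELS: `abs_keiperLiCoeff_sub_liMainTerm_le_of_riemannHypothesis` is RH-CONSEQUENCE·DERIVED
(J. C. Lagarias, *Li coefficients for automorphic L-functions*, Ann. Inst. Fourier 57 (2007), Thm. 1.1
(1.18) at `π = ζ`: under RH, `λ_n = (n/2) log n + C₁ n + O(√n log n)` — here with the EXPLICIT constant
`2` for all `n ≥ 900` (and `1/3` for `n ≥ 3·10⁵`), read off the cell rh-li's RH-FREE rung leaf
`LiAsymptoticLawQuadratic` (`liAsymptoticLawQuadratic_proof`, route `LiAsymptotic`, CLOSED) by taking the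
verified height `T = max 1000 (2√n)`, which RH supplies for every `n`);
`riemannHypothesis_iff_isBigO_keiperLiCoeff_sub_liMainTerm` is the column's FENCE record,
RH-EQUIVALENT·PRINTED (⟹ Lagarias 2007 Thm. 1.1; ⟸ Bombieri–Lagarias 1999 Thm. 1 / Voros 2006 §3, in
the tree as `Voros2006_thm_if_holds`: an `o(n)` law already forces RH), PROVED AS AN EQUIVALENCE.
bears_on: L-C/L-P (LADDER-RH §1 COLUMN 4 LI). WHAT THIS IS NOT: not a new rung and not progress on RH —
the RH-FREE content is the leaf `LiAsymptoticLawQuadratic` (finite verified height, `n ≤ T²/4`); removing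
the height restriction costs exactly RH, and the unrestricted band is RH-equivalent (no intermediate rung
between the verified-range law and RH along this axis). Nothing here bears on the truth of RH.

Filed by rh-crit-dbl-iso (C2 = de Branges + Li corpus; dbl-lead 2026-08-26T13:09:51Z item (3), flagged by
dbl-t11 g3 13:08:41Z) `--supports` the LI column's LiAsymptotic assembly item as a record decl; the LI
residual of record stays `LiTheory.LiOscDominatesTrend` (`Theorems/LiIsolationDefs.lean`).
-/

noncomputable section

-- D-0017: `Summit.<S>.<S>.…` is the designed namespace of a single-problem summit.
set_option linter.dupNamespace false

namespace Summit.RiemannHypothesis.RiemannHypothesis.Theorems.LiTheory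

open Literature.NumberTheory.LFunctions Literature.NumberTheory.DiophantineGeometry Filter Asymptotics
open scoped Topology

/-- **Lagarias 2007 Thm. 1.1 (1.18) at `π = ζ`, explicit: under RH, `|λ_n − (n/2) log n − C₁ n| ≤ 2√n log n`
for every `n ≥ 900`.** RH gives `RiemannHypothesisUpTo T` for `T = max 1000 (2√n)`, and `n ≤ T²/4`, so the
RH-FREE leaf `LiAsymptoticLawQuadratic` applies. RH-CONSEQUENCE·DERIVED; nothing here bears on the truth of RH.
[cite: Lagarias2007LiCoefficients, Thm. 1.1 eq. (1.18) p. 4] -/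
theorem abs_keiperLiCoeff_sub_liMainTerm_le_of_riemannHypothesis (hRH : _root_.RiemannHypothesis) {n : ℕ}
    (hn : 900 ≤ n) : |keiperLiCoeff n - liMainTerm n| ≤ 2 * Real.sqrt n * Real.log n := by
  have hT : (1000 : ℝ) ≤ max 1000 (2 * Real.sqrt n) := le_max_left _ _
  have hRHT := RiemannHypothesisUpTo.of_riemannHypothesis hRH (max 1000 (2 * Real.sqrt n))
  have hnT : (n : ℝ) ≤ 1 / 4 * (max 1000 (2 * Real.sqrt n)) ^ 2 := by
    have h1 : 2 * Real.sqrt n ≤ max 1000 (2 * Real.sqrt n) := le_max_right _ _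
    have h2 : (2 * Real.sqrt n) ^ 2 = 4 * n := by
      rw [mul_pow, Real.sq_sqrt (Nat.cast_nonneg n)]; norm_num
    have h3 : (2 * Real.sqrt n) ^ 2 ≤ (max 1000 (2 * Real.sqrt n)) ^ 2 :=
      pow_le_pow_left₀ (by positivity) h1 2
    linarith
  exact (liAsymptoticLawQuadratic_proof hT hRHT hnT).1 hn

/-- **The Turing-form constant: under RH, `|λ_n − (n/2) log n − C₁ n| ≤ (1/3)√n log n` for every `n ≥ 3·10⁵`.**
RH-CONSEQUENCE·DERIVED (same mechanism). [cite: Lagarias2007LiCoefficients, Thm. 1.1 eq. (1.18) p. 4] -/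
theorem abs_keiperLiCoeff_sub_liMainTerm_le_third_of_riemannHypothesis (hRH : _root_.RiemannHypothesis)
    {n : ℕ} (hn : 300000 ≤ n) : |keiperLiCoeff n - liMainTerm n| ≤ 1 / 3 * Real.sqrt n * Real.log n := by
  have hT : (1000 : ℝ) ≤ max 1000 (2 * Real.sqrt n) := le_max_left _ _
  have hRHT := RiemannHypothesisUpTo.of_riemannHypothesis hRH (max 1000 (2 * Real.sqrt n))
  have hnT : (n : ℝ) ≤ 1 / 4 * (max 1000 (2 * Real.sqrt n)) ^ 2 := by
    have h1 : 2 * Real.sqrt n ≤ max 1000 (2 * Real.sqrt n) := le_max_right _ _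
    have h2 : (2 * Real.sqrt n) ^ 2 = 4 * n := by
      rw [mul_pow, Real.sq_sqrt (Nat.cast_nonneg n)]; norm_num
    have h3 : (2 * Real.sqrt n) ^ 2 ≤ (max 1000 (2 * Real.sqrt n)) ^ 2 :=
      pow_le_pow_left₀ (by positivity) h1 2
    linarith
  exact (liAsymptoticLawQuadratic_proof hT hRHT hnT).2 hn

/-- The cell's main term `liMainTerm n = (n/2) log n + C₁ n` IS Oesterlé–Voros' `½ n (log n − 1 + γ − log 2π)`
(`C₁ = (γ − 1 − log 2π)/2`). RH-FREE bookkeeping. [cite: Lagarias2007LiCoefficients, eq. (1.11) p. 3] -/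
theorem liMainTerm_eq (n : ℕ) :
    liMainTerm n = (n : ℝ) / 2 *
      (Real.log n - 1 + Real.eulerMascheroniConstant - Real.log (2 * Real.pi)) := by
  unfold liMainTerm liC1
  ring

/-- **Under RH, `λ_n − liMainTerm n = O(√n log n)`** (Lagarias 2007 Thm. 1.1, the `O`-form, from the explicit
constant `2` beyond `n = 900`). RH-CONSEQUENCE·DERIVED. [cite: Lagarias2007LiCoefficients, Thm. 1.1 eq. (1.18) p. 4] -/
theorem isBigO_keiperLiCoeff_sub_liMainTerm_of_riemannHypothesis (hRH : _root_.RiemannHypothesis) :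
    (fun n : ℕ ↦ keiperLiCoeff n - liMainTerm n) =O[atTop] (fun n : ℕ ↦ Real.sqrt n * Real.log n) := by
  refine IsBigO.of_bound 2 ?_
  filter_upwards [eventually_ge_atTop 900] with n hn
  have hlog : 0 ≤ Real.log n := Real.log_natCast_nonneg n
  rw [Real.norm_eq_abs, Real.norm_eq_abs, abs_of_nonneg (mul_nonneg (Real.sqrt_nonneg _) hlog)]
  calc |keiperLiCoeff n - liMainTerm n| ≤ 2 * Real.sqrt n * Real.log n :=
        abs_keiperLiCoeff_sub_liMainTerm_le_of_riemannHypothesis hRH hn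
    _ = 2 * (Real.sqrt n * Real.log n) := by ring

/-- `√n log n = o(n)` along `ℕ` (plumbing: `log x = o(x^{1/2})`). [folklore] -/
theorem isLittleO_sqrt_mul_log_natCast :
    (fun n : ℕ ↦ Real.sqrt n * Real.log n) =o[atTop] (fun n : ℕ ↦ (n : ℝ)) := by
  have hlog : (fun x : ℝ ↦ Real.log x) =o[atTop] (fun x : ℝ ↦ x ^ (1 / 2 : ℝ)) :=
    isLittleO_log_rpow_atTop (by norm_num)
  have hsqrt : (fun x : ℝ ↦ Real.sqrt x) =O[atTop] (fun x : ℝ ↦ x ^ (1 / 2 : ℝ)) := by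
    refine IsBigO.of_bound 1 ?_
    filter_upwards [eventually_ge_atTop 0] with x hx
    rw [Real.sqrt_eq_rpow, one_mul]
  have hprod := hsqrt.mul_isLittleO hlog
  have hprod' : (fun x : ℝ ↦ Real.sqrt x * Real.log x) =o[atTop] (fun x : ℝ ↦ x) := by
    refine hprod.congr' EventuallyEq.rfl ?_
    filter_upwards [eventually_ge_atTop 0] with x hx
    rw [← Real.sqrt_eq_rpow, Real.mul_self_sqrt hx]
  exact hprod'.comp_tendsto tendsto_natCast_atTop_atTop

/-- **The converse: an `O(√n log n)` law forces RH** — indeed already an `o(n)` law does (Bombieri–Lagarias 1999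
Thm. 1 as used by Voros 2006 §3; the tree's `Voros2006_thm_if_holds`). RH-FREE theorem whose hypothesis is of
RH strength; nothing here bears on the truth of RH. [cite: Voros2006, §3 Theorem p.6 and the [BL] remark p.6] -/
theorem riemannHypothesis_of_isBigO_keiperLiCoeff_sub_liMainTerm
    (h : (fun n : ℕ ↦ keiperLiCoeff n - liMainTerm n) =O[atTop] (fun n : ℕ ↦ Real.sqrt n * Real.log n)) :
    _root_.RiemannHypothesis := by
  refine Voros2006_thm_if_holds ?_
  have h2 := h.trans_isLittleO isLittleO_sqrt_mul_log_natCast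
  refine h2.congr' (Eventually.of_forall fun n ↦ ?_) EventuallyEq.rfl
  simp only [liMainTerm_eq]

/-- **FENCE record of COLUMN 4 (LI): `RH ↔ λ_n − (n/2) log n − C₁ n = O(√n log n)`** — RH-EQUIVALENT·PRINTED
(⟹ Lagarias 2007 Thm. 1.1; ⟸ Bombieri–Lagarias 1999 / Voros 2006), PROVED AS AN EQUIVALENCE. The RH-FREE graded
statement short of it is the verified-range leaf `LiAsymptoticLawQuadratic` (`n ≤ T²/4`); the unrestricted band is
RH itself, so there is no intermediate rung on this axis. WHAT THIS IS NOT: an equivalence is not evidence for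
either side; nothing here bears on the truth of RH.
[cite: Lagarias2007LiCoefficients, Thm. 1.1 eq. (1.18) p. 4] [cite: Voros2006, §3 Theorem p.6] -/
theorem riemannHypothesis_iff_isBigO_keiperLiCoeff_sub_liMainTerm :
    _root_.RiemannHypothesis ↔
      (fun n : ℕ ↦ keiperLiCoeff n - liMainTerm n) =O[atTop] (fun n : ℕ ↦ Real.sqrt n * Real.log n) :=
  ⟨isBigO_keiperLiCoeff_sub_liMainTerm_of_riemannHypothesis,
    riemannHypothesis_of_isBigO_keiperLiCoeff_sub_liMainTerm⟩

/-- The same fence with the summit statement on the left. [cite: Lagarias2007LiCoefficients, Thm. 1.1 eq. (1.18) p. 4] -/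
theorem summit_iff_isBigO_keiperLiCoeff_sub_liMainTerm :
    Summit.RiemannHypothesis ↔
      (fun n : ℕ ↦ keiperLiCoeff n - liMainTerm n) =O[atTop] (fun n : ℕ ↦ Real.sqrt n * Real.log n) :=
  riemannHypothesis_iff_isBigO_keiperLiCoeff_sub_liMainTerm

end Summit.RiemannHypothesis.RiemannHypothesis.Theorems.LiTheory

end
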